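import Summits.RiemannHypothesis.RiemannHypothesis.Theorems.HandoffSplitKernel
import HarnessLib

/-!
# The level at which a verified-zero certificate sees an arbitrary window test (handoff prove-1, ATTEMPT-19)

Companion of `HandoffReachCeiling` (THEOREM R): for a split kernel `φ` (`0 ≤ Φ ≤ 1` on the line) and
ANY Weil test `g`, the verified Gram form and the line mass beyond the infrared height are controlled
by the strip-decay constant `C_g = weilDecayConst g` alone:
* `verifiedGramK_le_of_decay`: `𝒱_φ(g) ≤ C_g² · Σ_{ρ ∈ weilZeroIndex T₀} m(ρ)/(1+γ²)²`;
* `weilNorm2Sq_sub_band_le_of_decay`: `‖g‖₂² - B_h(g) ≤ C_g²/(2(1+h²))` (`B_h` the line mass on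
  `|t| < |h|`; Plancherel, `|ĝ(1/2+it)| ≤ C_g/(1+t²)`, `∫(1+t²)⁻¹ = π`);
* `adversary_level_le`: hence `𝒱_φ(g) + c(‖g‖₂² - B_h(g)) ≤ C_g²(W_{T₀} + c/(2(1+h²)))` for `c ≥ 0`.
With `HandoffReachCeiling.log_reach_ceiling` this makes THEOREM R's ceiling unconditional in the
adversary (paper: handoff/prove-1 ATTEMPT-19 COROLLARY R-C).  No hypothesis on the zeros of `ζ`;
nothing here bears on the truth of RH.
-/

set_option linter.dupNamespace false  -- the mandated namespace repeats `RiemannHypothesis`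

open scoped Real
open Complex MeasureTheory Set Filter Literature.NumberTheory.LFunctions
  Literature.Analysis.SpecialFunctions

namespace Summit.RiemannHypothesis.RiemannHypothesis.Theorems

variable {g φ : ℝ → ℂ} {δ : ℝ}

/-- The verified Gram form of ANY test is bounded through the strip decay constant:
`𝒱_φ(g) ≤ C_g² · Σ_{ρ ∈ weilZeroIndex T₀} m(ρ)/(1 + γ²)²` (`‖ĝ(1/2+iγ)‖ ≤ C_g/(1+γ²)`, `0 ≤ Φ ≤ 1`). -/
theorem verifiedGramK_le_of_decay (hg : IsWeilTest g) (hφ : IsSplitKernel φ δ) (T₀ : ℝ) :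
    verifiedGramK g φ T₀ ≤ weilDecayConst g ^ 2 *
      ∑ᶠ ρ ∈ weilZeroIndex T₀, (riemannZetaZeroOrder ρ : ℝ) / (1 + ρ.im ^ 2) ^ 2 := by
  have hfin := weilZeroIndex_finite T₀
  unfold verifiedGramK
  rw [finsum_mem_eq_finite_toFinset_sum _ hfin, finsum_mem_eq_finite_toFinset_sum _ hfin,
    Finset.mul_sum]
  refine Finset.sum_le_sum fun ρ hρ ↦ ?_
  rw [Set.Finite.mem_toFinset] at hρ
  obtain ⟨-, hre0, hre1, him, -⟩ := hρ
  have hm0 : (0 : ℝ) ≤ riemannZetaZeroOrder ρ := by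
    exact_mod_cast riemannZetaZeroOrder_nonneg (fun h ↦ him (by rw [h]; simp))
  have hpos : 0 < 1 + ρ.im ^ 2 := by positivity
  have hdec : ‖weilMellin g (1 / 2 + ρ.im * I)‖ ≤ weilDecayConst g / (1 + ρ.im ^ 2) := by
    have := norm_weilMellin_le hg (s := 1 / 2 + ρ.im * I) (by simp) (by norm_num)
    simpa using this
  have hG : lowLineDensityK g φ ρ.im ≤ weilDecayConst g ^ 2 / (1 + ρ.im ^ 2) ^ 2 := by
    unfold lowLineDensityK
    have h0 : 0 ≤ ‖weilMellin g (1 / 2 + ρ.im * I)‖ := norm_nonneg _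
    have h1 : ‖weilMellin g (1 / 2 + ρ.im * I)‖ ^ 2 ≤ (weilDecayConst g / (1 + ρ.im ^ 2)) ^ 2 :=
      pow_le_pow_left₀ h0 hdec 2
    have h2 : lineSymbol φ ρ.im ≤ 1 := hφ.line_le_one _
    have h3 : 0 ≤ lineSymbol φ ρ.im := hφ.line_nonneg _
    calc ‖weilMellin g (1 / 2 + ρ.im * I)‖ ^ 2 * lineSymbol φ ρ.im
        ≤ (weilDecayConst g / (1 + ρ.im ^ 2)) ^ 2 * 1 :=
          mul_le_mul h1 h2 h3 (sq_nonneg _)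
      _ = weilDecayConst g ^ 2 / (1 + ρ.im ^ 2) ^ 2 := by rw [mul_one, div_pow]
  calc (riemannZetaZeroOrder ρ : ℝ) * lowLineDensityK g φ ρ.im
      ≤ (riemannZetaZeroOrder ρ : ℝ) * (weilDecayConst g ^ 2 / (1 + ρ.im ^ 2) ^ 2) :=
        mul_le_mul_of_nonneg_left hG hm0
    _ = weilDecayConst g ^ 2 * ((riemannZetaZeroOrder ρ : ℝ) / (1 + ρ.im ^ 2) ^ 2) := by ring

/-- The line mass of ANY test beyond `|h|` is at most `C_g²/(2(1 + h²))`
(`|ĝ(1/2+it)|² ≤ C_g²/((1+h²)(1+t²))` there and `∫ (1+t²)⁻¹ = π`). -/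
theorem weilNorm2Sq_sub_band_le_of_decay (hg : IsWeilTest g) (h : ℝ) :
    weilNorm2Sq g - (2 * π)⁻¹ * ∫ t in Ioo (-|h|) |h|, ‖weilMellin g (1 / 2 + t * I)‖ ^ 2 ≤
      weilDecayConst g ^ 2 / (2 * (1 + h ^ 2)) := by
  -- the tail is `(2π)⁻¹ ∫_{|t| ≥ |h|} |ĝ|²` (Plancherel + splitting the line at `±|h|`)
  have hsplit := integral_add_compl (μ := volume) measurableSet_Ioo
    (integrable_norm_sq_weilMellin_half_line hg) (s := Ioo (-|h|) |h|)
  rw [integral_norm_sq_weilMellin_half_line hg] at hsplit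
  have htail : weilNorm2Sq g - (2 * π)⁻¹ * ∫ t in Ioo (-|h|) |h|, ‖weilMellin g (1 / 2 + t * I)‖ ^ 2 =
      (2 * π)⁻¹ * ∫ t in (Ioo (-|h|) |h|)ᶜ, ‖weilMellin g (1 / 2 + t * I)‖ ^ 2 := by
    have hπ : (0 : ℝ) < 2 * π := by positivity
    have : weilNorm2Sq g = (2 * π)⁻¹ * ((∫ t in Ioo (-|h|) |h|, ‖weilMellin g (1 / 2 + t * I)‖ ^ 2) +
        ∫ t in (Ioo (-|h|) |h|)ᶜ, ‖weilMellin g (1 / 2 + t * I)‖ ^ 2) := by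
      rw [hsplit]; field_simp
    rw [this]; ring
  rw [htail]
  set C := weilDecayConst g with hC
  have hC0 : 0 ≤ C := weilDecayConst_nonneg g
  have hh1 : 0 < 1 + h ^ 2 := by positivity
  have hfi := integrable_norm_sq_weilMellin_half_line hg
  have hbi : Integrable fun t : ℝ ↦ C ^ 2 / (1 + h ^ 2) * (1 + t ^ 2)⁻¹ :=
    (integrable_inv_one_add_sq).const_mul _
  have hpt : ∀ t ∈ (Ioo (-|h|) |h|)ᶜ,
      ‖weilMellin g (1 / 2 + t * I)‖ ^ 2 ≤ C ^ 2 / (1 + h ^ 2) * (1 + t ^ 2)⁻¹ := by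
    intro t ht
    have hth : |h| ≤ |t| := by
      simp only [mem_compl_iff, mem_Ioo, not_and_or, not_lt] at ht
      rcases ht with ht | ht
      · have : t ≤ -|h| := ht
        calc |h| ≤ -t := by linarith
          _ ≤ |t| := neg_le_abs t
      · exact ht.trans (le_abs_self t)
    have ht2 : 1 + h ^ 2 ≤ 1 + t ^ 2 := by
      have := sq_le_sq' (by linarith [abs_nonneg h, neg_abs_le h]) hth
      rw [sq_abs, sq_abs] at this; linarith
    have ht1 : 0 < 1 + t ^ 2 := by positivity
    have hdec : ‖weilMellin g (1 / 2 + t * I)‖ ≤ C / (1 + t ^ 2) := by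
      have := norm_weilMellin_le hg (s := 1 / 2 + t * I) (by simp) (by norm_num)
      simpa [hC] using this
    have h0 : 0 ≤ ‖weilMellin g (1 / 2 + t * I)‖ := norm_nonneg _
    calc ‖weilMellin g (1 / 2 + t * I)‖ ^ 2 ≤ (C / (1 + t ^ 2)) ^ 2 := pow_le_pow_left₀ h0 hdec 2
      _ = C ^ 2 / (1 + t ^ 2) * (1 + t ^ 2)⁻¹ := by rw [div_pow]; field_simp
      _ ≤ C ^ 2 / (1 + h ^ 2) * (1 + t ^ 2)⁻¹ := by
          refine mul_le_mul_of_nonneg_right ?_ (by positivity)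
          exact div_le_div_of_nonneg_left (sq_nonneg _) hh1 ht2
  have hmono : ∫ t in (Ioo (-|h|) |h|)ᶜ, ‖weilMellin g (1 / 2 + t * I)‖ ^ 2 ≤
      ∫ t in (Ioo (-|h|) |h|)ᶜ, C ^ 2 / (1 + h ^ 2) * (1 + t ^ 2)⁻¹ :=
    setIntegral_mono_on hfi.integrableOn hbi.integrableOn measurableSet_Ioo.compl hpt
  have hall : ∫ t in (Ioo (-|h|) |h|)ᶜ, C ^ 2 / (1 + h ^ 2) * (1 + t ^ 2)⁻¹ ≤
      ∫ t, C ^ 2 / (1 + h ^ 2) * (1 + t ^ 2)⁻¹ :=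
    setIntegral_le_integral hbi (Eventually.of_forall fun t ↦ by positivity)
  have hI : ∫ t : ℝ, C ^ 2 / (1 + h ^ 2) * (1 + t ^ 2)⁻¹ = C ^ 2 / (1 + h ^ 2) * π := by
    rw [integral_const_mul, integral_univ_inv_one_add_sq]
  rw [hI] at hall
  have hπ : (0 : ℝ) < 2 * π := by positivity
  calc (2 * π)⁻¹ * ∫ t in (Ioo (-|h|) |h|)ᶜ, ‖weilMellin g (1 / 2 + t * I)‖ ^ 2
      ≤ (2 * π)⁻¹ * (C ^ 2 / (1 + h ^ 2) * π) :=
        mul_le_mul_of_nonneg_left (hmono.trans hall) (by positivity)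
    _ = C ^ 2 / (2 * (1 + h ^ 2)) := by field_simp

/-- **The adversary level of an arbitrary window test.** For `c ≥ 0`,
`𝒱_φ(g) + c(‖g‖₂² - B_h(g)) ≤ C_g² · (W_{T₀} + c/(2(1+h²)))`. -/
theorem adversary_level_le (hg : IsWeilTest g) (hφ : IsSplitKernel φ δ) (T₀ h : ℝ) {c : ℝ}
    (hc : 0 ≤ c) :
    verifiedGramK g φ T₀ +
        c * (weilNorm2Sq g - (2 * π)⁻¹ * ∫ t in Ioo (-|h|) |h|, ‖weilMellin g (1 / 2 + t * I)‖ ^ 2) ≤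
      weilDecayConst g ^ 2 *
        ((∑ᶠ ρ ∈ weilZeroIndex T₀, (riemannZetaZeroOrder ρ : ℝ) / (1 + ρ.im ^ 2) ^ 2)
          + c / (2 * (1 + h ^ 2))) := by
  have h1 := verifiedGramK_le_of_decay hg hφ T₀
  have h2 := mul_le_mul_of_nonneg_left (weilNorm2Sq_sub_band_le_of_decay hg h) hc
  have e : c * (weilDecayConst g ^ 2 / (2 * (1 + h ^ 2))) = weilDecayConst g ^ 2 * (c / (2 * (1 + h ^ 2))) := by
    ring
  rw [e] at h2
  linarith

end Summit.RiemannHypothesis.RiemannHypothesis.Theorems
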